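import Literature.AnabelianGeometry.EtaleTheta.Discharge.Sec2TowerLemmas
import Mathlib.Data.Nat.Nth
import Mathlib.Data.Set.Finite.Lattice

/-!
# [EtTh] §2 discharge: every tower of theta-environment data carries a compatible family of theta
# cocycles, hence its NATURAL projective system of mono-theta environments (`MTESystem` is inhabited)

Mochizuki, *The Étale Theta Function and its Frobenioid-theoretic Manifestations* [EtTh],
Publ. RIMS 45 (2009), §2, Def 2.13 (ii) pp.47–48 ("`M_{N'}` … the mod `N'` mono-theta environment
induced by `M`"), Cor 2.16 p.54 ("its natural system of model … environments `β = red`"),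
Cor 2.19 (ii) p.64 ("by letting the integer `N` vary in `E`, we obtain a natural projective system
of mono-theta environments") (locators `p.N` = PDF pages of the PRIMS text; bib key
`MochizukiEtTh2009`). PROOF-ONLY companion (no `def`, no new named fact; seat abc-iut-w5-d071,
L2-lead row «NV-L2/ThetaEnvTower.MTESystem», DAG node `EtTh:Cor2.19(ii)`) of `ThetaSystems.lean`
(seat abc-iut-L2-t2; nothing there is edited or restated).

* `ThetaEnvTower.exists_compatible_thetaCocycles` — for EVERY tower `T : ThetaEnvTower E` there is a
  family `η_M ∈ T.thetaCocycles M`, `M ∈ E`, with `red_{M',M} ∘ η_{M'} = η_M` for all `M ∣ M'`.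
  Proof: `E ⊆ ℕ≥1` is cofinal for `∣` and totally ordered by `∣`, hence order-isomorphic to `ℕ`
  (enumeration by `Nat.nth`); choose `η` at the first level and lift successively along the
  enumeration by the tower axiom "the mod-`M` cocycles are the reductions of the mod-`M'` cocycles —
  all of them" (`red_cocycle_surj`, dependent choice); coherence along non-consecutive levels is
  `red_comp` / `red_self`.
* `ThetaEnvTower.exists_MTESystem_of_compatible` — the NATURAL system on a given compatible family
  (all twists `a_{M',M} = 1`; `isAut` by `MonoThetaEnv.Iso.refl`, the cocycle identity by
  `redEnv_comp`).
* `ThetaEnvTower.exists_MTESystem_natural`, `ThetaEnvTower.nonempty_MTESystem` — consequently the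
  interface `MTESystem` (projective systems of mono-theta environments, Cor 2.19 (ii)) is INHABITED
  over every tower, with zero hypotheses; in particular at both kernel producers of `ThetaEnvTower`
  (`ThetaSetting.EtaleThetaData.DoubleUnderline.thetaEnvTower`, `TowerOfSetting.lean`, and
  `Literature.IUT.HodgeArakelov.EtaleLevels.tower`), and the binders `(η₀, hη₀, hη₀c)` ("ANY fixed
  compatible family") of `ThetaEnvTower.exists_iso_of_systems` (`Sec2DiscreteRigidityStrong.lean`)
  are dischargeable for every tower.

HONEST FRAMING: non-vacuity of the TYPED interface (every tower), not a statement about the genuine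
[EtTh] objects; inhabited ≠ endorsed; no side is taken on [IUTchIII] Cor 3.12; typed ≠ discharged
elsewhere.
-/

namespace Literature.AnabelianGeometry.EtaleTheta

universe u

namespace ThetaEnvTower

variable {E : Set ℕ+} (T : ThetaEnvTower.{u} E)

/-- **Every tower of theta-environment data carries a compatible family of theta cocycles**:
there are `η_M ∈ T.thetaCocycles M` (`M ∈ E`) with `red_{M',M} ∘ η_{M'} = η_M` whenever `M ∣ M'`
("by letting the integer `N` vary in `E`, we obtain a natural projective system", Cor 2.19 (ii);
the members `η̈^Θ` of Cor 2.16). Dependent choice along the enumeration of the cofinal, totally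
ordered index set `E ≅ ℕ`, lifting level by level by `red_cocycle_surj`.
[cite: MochizukiEtTh2009, Cor 2.19(ii) p.64] -/
theorem exists_compatible_thetaCocycles :
    ∃ η : ∀ M : E, T.PiYdd → T.mu M,
      (∀ M, η M ∈ T.thetaCocycles M) ∧
      ∀ (M M' : E) (h : (M : ℕ+) ∣ M'), T.red M M' h ∘ η M' = η M := by
  classical
  -- the copy of `E` inside `ℕ`
  let p : ℕ → Prop := fun n => ∃ M : E, ((M : ℕ+) : ℕ) = n
  -- `E` is infinite (cofinality)
  have hp : (setOf p).Infinite := by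
    refine Set.infinite_of_not_bddAbove ?_
    rintro ⟨B, hB⟩
    obtain ⟨M, hME, hdvd⟩ := T.cofinal (Nat.succPNat B)
    have h1 : ((Nat.succPNat B : ℕ+) : ℕ) ≤ ((M : ℕ+) : ℕ) := by
      exact_mod_cast PNat.le_of_dvd hdvd
    rw [Nat.succPNat_coe] at h1
    have h2 : ((M : ℕ+) : ℕ) ≤ B := hB (show ((M : ℕ+) : ℕ) ∈ setOf p from ⟨⟨M, hME⟩, rfl⟩)
    omega
  -- the increasing enumeration `e : ℕ → E` of `E`
  have he : ∀ k : ℕ, ∃ M : E, ((M : ℕ+) : ℕ) = Nat.nth p k := fun k => Nat.nth_mem_of_infinite hp k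
  choose e he using he
  have he_mono : ∀ {i j : ℕ}, i ≤ j → ((e i : ℕ+) : ℕ) ≤ ((e j : ℕ+) : ℕ) := fun hij => by
    rw [he, he]
    exact (Nat.nth_le_nth hp).2 hij
  -- consecutive (indeed all comparable) levels divide one another (`E` is totally ordered by `∣`)
  have hdvd : ∀ {i j : ℕ}, i ≤ j → ((e i : ℕ+) ∣ (e j : ℕ+)) := fun {i j} hij => by
    rcases T.total _ (e i).2 _ (e j).2 with h | h
    · exact h
    · have hle : ((e j : ℕ+) : ℕ) ≤ ((e i : ℕ+) : ℕ) := by exact_mod_cast PNat.le_of_dvd h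
      have heq : ((e i : E) : ℕ+) = (e j : ℕ+) := PNat.eq (le_antisymm (he_mono hij) hle)
      rw [heq]
  -- every `M ∈ E` is enumerated
  have hidx : ∀ M : E, ∃ k, e k = M := fun M => by
    have hM : ((M : ℕ+) : ℕ) ∈ Set.range (Nat.nth p) := by
      rw [Nat.range_nth_of_infinite hp]
      exact ⟨M, rfl⟩
    obtain ⟨k, hk⟩ := hM
    refine ⟨k, Subtype.ext (PNat.eq ?_)⟩
    rw [he, hk]
  choose idx hidx using hidx
  have hidx_mono : ∀ {M M' : E}, ((M : ℕ+) ∣ M') → idx M ≤ idx M' := fun {M M'} h => by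
    have hle : ((M : ℕ+) : ℕ) ≤ ((M' : ℕ+) : ℕ) := by exact_mod_cast PNat.le_of_dvd h
    refine (Nat.nth_le_nth hp).1 ?_
    rw [← he (idx M), ← he (idx M'), hidx M, hidx M']
    exact hle
  -- dependent choice: lift a level-`e 0` cocycle successively along the enumeration
  have hstep : ∀ (k : ℕ) (ηk : {η : T.PiYdd → T.mu (e k) // η ∈ T.thetaCocycles (e k)}),
      ∃ η' : {η : T.PiYdd → T.mu (e (k + 1)) // η ∈ T.thetaCocycles (e (k + 1))},
        T.red (e k) (e (k + 1)) (hdvd k.le_succ) ∘ η'.1 = ηk.1 := fun k ηk => by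
    obtain ⟨η', h₁, h₂⟩ := T.red_cocycle_surj (e k) (e (k + 1)) (hdvd k.le_succ) ηk.1 ηk.2
    exact ⟨⟨η', h₁⟩, h₂⟩
  choose step hstep using hstep
  obtain ⟨g, g_succ⟩ :
      ∃ g : ∀ k : ℕ, {η : T.PiYdd → T.mu (e k) // η ∈ T.thetaCocycles (e k)},
        ∀ k, g (k + 1) = step k (g k) :=
    ⟨fun k => Nat.rec (motive := fun k => {η : T.PiYdd → T.mu (e k) // η ∈ T.thetaCocycles (e k)})
        ⟨(T.thetaCocycles_nonempty (e 0)).some, (T.thetaCocycles_nonempty (e 0)).some_mem⟩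
        step k,
      fun _ => rfl⟩
  have g_red_succ : ∀ k, T.red (e k) (e (k + 1)) (hdvd k.le_succ) ∘ (g (k + 1)).1 = (g k).1 :=
    fun k => by rw [g_succ]; exact hstep k (g k)
  -- coherence along the whole enumeration
  have g_le : ∀ (i j : ℕ) (hij : i ≤ j), T.red (e i) (e j) (hdvd hij) ∘ (g j).1 = (g i).1 := by
    intro i j hij
    induction j, hij using Nat.le_induction with
    | base =>
      funext x
      exact T.red_self _ _ _
    | succ j hij ih =>
      rw [← ih, ← g_red_succ j]
      funext x
      exact T.red_comp (e i) (e j) (e (j + 1)) (hdvd hij) (hdvd j.le_succ) _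
  -- the family: `η_M := red_{e (idx M), M} ∘ g_{idx M}` (the reduction along `e (idx M) = M`)
  have hM : ∀ M : E, (M : ℕ+) ∣ (e (idx M) : ℕ+) := fun M =>
    dvd_of_eq (congrArg Subtype.val (hidx M)).symm
  refine ⟨fun M => T.red M (e (idx M)) (hM M) ∘ (g (idx M)).1,
    fun M => T.red_cocycle_mem _ _ _ _ (g (idx M)).2, fun M M' h => ?_⟩
  funext x
  change T.red M M' h (T.red M' (e (idx M')) (hM M') ((g (idx M')).1 x)) =
    T.red M (e (idx M)) (hM M) ((g (idx M)).1 x)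
  rw [← T.red_comp M M' (e (idx M')) h (hM M'), ← g_le (idx M) (idx M') (hidx_mono h)]
  exact T.red_comp M (e (idx M)) (e (idx M')) (hM M) (hdvd (hidx_mono h)) _

/-- **The natural projective system of mono-theta environments on a compatible family** (Cor 2.19
(ii); Cor 2.16 "natural system … `β = red`"): given cocycles `η_M ∈ T.thetaCocycles M` with
`red ∘ η_{M'} = η_M`, the models `M_M = M(η_M)` with the untwisted transition maps `red_{M',M}`
(all `a_{M',M} = 1`) form an `MTESystem`. [cite: MochizukiEtTh2009, Cor 2.19(ii) p.64] -/
theorem exists_MTESystem_of_compatible (η : ∀ M : E, T.PiYdd → T.mu M)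
    (hη : ∀ M, η M ∈ T.thetaCocycles M)
    (hc : ∀ (M M' : E) (h : (M : ℕ+) ∣ M'), T.red M M' h ∘ η M' = η M) :
    ∃ S : T.MTESystem, S.η = η ∧ ∀ (M M' : E) (h : (M : ℕ+) ∣ M'), S.a M M' h = 1 :=
  ⟨{ η := η
     mem := hη
     compat := hc
     a := fun _ _ _ => 1
     isAut := fun M _ _ => ⟨MonoThetaEnv.Iso.refl _, rfl⟩
     a_self := fun _ _ => rfl
     a_comp := fun M M' M'' h h' x => by
       simp only [MulAut.one_apply]
       exact T.redEnv_comp M M' M'' h h' x }, rfl, fun _ _ _ => rfl⟩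

/-- **The natural projective system exists over every tower** ("by letting the integer `N` vary in
`E`, we obtain a natural projective system of mono-theta environments", Cor 2.19 (ii)): some
`MTESystem` with all twists `a_{M',M} = 1`. [cite: MochizukiEtTh2009, Cor 2.19(ii) p.64] -/
theorem exists_MTESystem_natural :
    ∃ S : T.MTESystem, ∀ (M M' : E) (h : (M : ℕ+) ∣ M'), S.a M M' h = 1 := by
  obtain ⟨η, hη, hc⟩ := T.exists_compatible_thetaCocycles
  obtain ⟨S, -, hS⟩ := T.exists_MTESystem_of_compatible η hη hc
  exact ⟨S, hS⟩

/-- **Non-vacuity of `MTESystem`**: over EVERY tower of theta-environment data the type of projective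
systems of mono-theta environments (Cor 2.19 (ii)) is inhabited.
[cite: MochizukiEtTh2009, Cor 2.19(ii) p.64] -/
theorem nonempty_MTESystem : Nonempty T.MTESystem := by
  obtain ⟨S, -⟩ := T.exists_MTESystem_natural
  exact ⟨S⟩

end ThetaEnvTower

end Literature.AnabelianGeometry.EtaleTheta
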